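import Summits.CriticalPhenomena.PercolationContinuityZ3.Theorems.PercNearOneGluingNoHeavyQuantConvAtomsReduction
import Summits.CriticalPhenomena.PercolationContinuityZ3.Theorems.PercNearOneGluingNoHeavyQuantConvAtomsTrivialSide
import Summits.CriticalPhenomena.PercolationContinuityZ3.Theorems.PercNearOneGluingNoHeavyQuantLightSliceCore
import HarnessLib

/-!
# QUANT lane R8, T-DEC: **THE ASSEMBLY OF (II)** — `ConvClosedTAtomsOrd ⟸ LightSliceCore` (selection: trivial side / non-low head cell / shorter light
# segment / symmetry), hence `ConvClosedT ⟸ LightSliceCore` and `FarTreeRow ⟸ LightSliceCore ∧ GatedConvEmptyFree` (census-2 g58)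

builds on p205010 (kernel theorem, internal audit signed; external expert review pending)

Support file (`--supports stmt-CriticalPhenomena-4575`), QUANT lane seat prim-quant-census-2 (gen 58), rung R8 of
`run/shared/lean/prim/quant/LADDER.md`.  Theorems only, standard axioms, no sorries.  Memo `…/prim-quant-census-2-g58/EXTREME-ATOMS-G58.md` §3.

* `not_both_headLow` — the selection lemma (census-1 g21 §3 (b)): `2(l₁′+h₂′) < T₁+T₂` and `2(l₂′+h₁′) < T₁+T₂` contradict the compatibilities.
* **`convClosedTAtomsOrd_of_lightSliceCore : LightSliceCore → ConvClosedTAtomsOrd`** — not deep ⟹ `lconv_atoms_decAtT_of_not_deep(')`; doubly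
  deep ⟹ a side with a non-low lowest head cell and the shorter light segment exists (if exactly one side has a non-low head cell its segment is the
  shorter one: `l₂′ + h₁′ < l₁′ + h₂′`), it is side 1 up to `lconv_comm`, and `LightSliceCore` + `lconv_atomLaw_decAtT_of_lightSlice` close.
* `lightSlice_decAtT_of_pieces` — the light slice is the mixture of the two ≤ 4-cell pieces light⊗heavy and light⊗light (`atomLaw_eq_mixture` on the
  second atom): both pieces DEC ⟹ the light slice DEC (lead g26's class P2; plug for the standalone piece lemmas `tfp_core`, `twoBlob_…`).
* `convClosedT_of_lightSliceCore`, `sdecConvClosed_of_lightSliceCore`, `treeBuiltDEC_of_lightSliceCore`, `Quant.treeDEC_of_lightSliceCore`,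
  **`Quant.farTreeRow_of_lightSliceCore : LightSliceCore → GatedConvEmptyFree → FarTreeRow`** (CONDITIONAL: both `@[conjecture]`).

STATE OF (II) AFTER THIS FILE: the law-level statement of record can be `LawDec.LightSliceCore` — ONE light-slice inequality family (census-1's
LS-CORE, explicit atoms, ordered, doubly deep, ¬A2, span tie-break); everything else of (II) is kernel.  HONEST: `LightSliceCore`, (III), hence
`ConvClosedT`, `SDECConvClosed`, `TreeBuiltDEC`, `TreeDEC`, `FarTreeRow` OPEN.  [this work]; nothing here is cited as a published result.  The gluing rows served [cite: KozmaNitzan2024, Conjecture 3 (p. 15)]; product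
measure [cite: Grimmett1999, §1.3 p. 10].
-/

noncomputable section

namespace Summit.CriticalPhenomena.PercolationContinuityZ3.Theorems

namespace Quant

open Finset

/-- the two-point law `{lo, hi; g}` (as in `…QuantLawDEC`) -/
local notation3 "TP[" lo ", " hi ", " g ", " h "]" =>
  (g : ℝ) * (if (h : ℕ) = (hi : ℕ) then (1 : ℝ) else 0) + (1 - (g : ℝ)) * (if (h : ℕ) = (lo : ℕ) then (1 : ℝ) else 0)

namespace LawDec

/-! ### The selection and the assembly -/

/-- **THE SELECTION LEMMA** (census-1 g21 §3 (b), explicit atoms): in the doubly deep configuration the two lowest head cells `l₁′ + h₂′`,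
`l₂′ + h₁′` are not both conv-lows. [this work] -/
theorem not_both_headLow {T₁ T₂ : ℝ} {l₁' h₁' l₂' h₂' : ℕ} (hc₁ : T₁ < (l₁' : ℝ) + h₁') (hc₂ : T₂ < (l₂' : ℝ) + h₂') :
    ¬ (2 * ((l₁' : ℝ) + h₂') < T₁ + T₂ ∧ 2 * ((l₂' : ℝ) + h₁') < T₁ + T₂) := by
  rintro ⟨h1, h2⟩; linarith

/-- **`ConvClosedTAtomsOrd` ⟸ `LightSliceCore`** — the selection: a non-deep cheap low is the trivial side (`lconv_atoms_decAtT_of_not_deep(')`);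
in the doubly deep configuration a side with a non-low lowest head cell and the shorter light segment exists (`not_both_headLow`; if only one side
qualifies its segment is the shorter one), it is side 1 up to the symmetry `lconv_comm`, and there `LightSliceCore` gives the light slice, hence the
convolution (`lconv_atomLaw_decAtT_of_lightSlice`). [this work] -/
theorem convClosedTAtomsOrd_of_lightSliceCore (hL : LightSliceCore) : ConvClosedTAtomsOrd := by
  -- one ordered side, given its light slice from `hL`
  have side : ∀ (x T₁ T₂ : ℝ) (M₁ M₂ j : ℕ) (l₁ h₁ l₁' h₁' l₂ h₂ l₂' h₂' : ℕ),
      0 < x → x < 1 → j < M₁ + M₂ →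
      AtomData x T₁ j M₁ l₁ h₁ l₁' h₁' → AtomData x T₂ j M₂ l₂ h₂ l₂' h₂' →
      l₁ < l₁' → h₁' ≤ h₁ → l₂ < l₂' → h₂' ≤ h₂ →
      (∀ j'', j'' ≤ j → j ≤ j'' + M₂ → DECAtT x T₁ j'' M₁ (atomLaw x T₁ j l₁ h₁ l₁' h₁')) →
      (∀ j'', j'' ≤ j → j ≤ j'' + M₁ → DECAtT x T₂ j'' M₂ (atomLaw x T₂ j l₂ h₂ l₂' h₂')) →
      ¬ BDECAtT x T₁ j M₁ M₂ (atomLaw x T₁ j l₁ h₁ l₁' h₁') → ¬ BDECAtT x T₂ j M₂ M₁ (atomLaw x T₂ j l₂ h₂ l₂' h₂') →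
      l₁' + h₂' ≤ j → l₂' + h₁' ≤ j → T₁ + T₂ ≤ 2 * ((l₁' : ℝ) + h₂') → h₁' + l₂' ≤ h₂' + l₁' →
      DECAtT x (T₁ + T₂) j (M₁ + M₂) (lconv M₁ M₂ (atomLaw x T₁ j l₁ h₁ l₁' h₁') (atomLaw x T₂ j l₂ h₂ l₂' h₂')) := by
    intro x T₁ T₂ M₁ M₂ j l₁ h₁ l₁' h₁' l₂ h₂ l₂' h₂' hx0 hx1 hj hd₁ hd₂ o1 o2 o3 o4 hw₁ hw₂ hb₁ hb₂ dd1 dd2 na sp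
    obtain ⟨hl2, hl2'⟩ := hd₂.lt_of
    have hd₂' := hd₂
    obtain ⟨a1, a2, a3, a4, a5, b1, b2, b3, b4, b5, hne, c2, c1⟩ := hd₂'
    have hc₂ : 0 ≤ usage x T₂ j l₂' h₂' := (usage_pos_of_compat x T₂ j l₂' h₂' hx0 hx1 b2 hl2' (Or.inr b5)).le
    have hcc : usage x T₂ j l₂ h₂ ≠ usage x T₂ j l₂' h₂' := ne_of_gt (c2.trans c1)
    have n2 : ∀ b, 0 ≤ atomLaw x T₂ j l₂ h₂ l₂' h₂' b := atomLaw_nonneg x T₂ j l₂ h₂ l₂' h₂' hx1 hc₂ c2 c1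
    have z2 : ∀ b, M₂ < b → atomLaw x T₂ j l₂ h₂ l₂' h₂' b = 0 := fun b hb =>
      atomLaw_eq_zero_of_gt x T₂ j l₂ h₂ l₂' h₂' (by omega) a4 (by omega) b4 hb
    have s2 := sum_range_atomLaw x T₂ j l₂ h₂ l₂' h₂' hx1 hcc (show l₂ ≤ M₂ by omega) a4 (show l₂' ≤ M₂ by omega) b4
    exact lconv_atomLaw_decAtT_of_lightSlice x T₁ T₂ j M₁ M₂ l₁ h₁ l₁' h₁' _ hx0 hx1 hd₁ n2 z2 s2 hw₂
      (hL x T₁ T₂ M₁ M₂ j l₁ h₁ l₁' h₁' l₂ h₂ l₂' h₂' hx0 hx1 hj hd₁ hd₂ o1 o2 o3 o4 hw₁ hw₂ hb₁ hb₂ dd1 dd2 na sp)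
  intro x T₁ T₂ M₁ M₂ j l₁ h₁ l₁' h₁' l₂ h₂ l₂' h₂' hx0 hx1 hj hd₁ hd₂ o1 o2 o3 o4 hw₁ hw₂ hb₁ hb₂
  have hd₁' := hd₁
  obtain ⟨-, -, -, -, -, -, p2, -, -, p5, -, -, -⟩ := hd₁'
  have hd₂' := hd₂
  obtain ⟨-, -, -, -, -, -, q2, -, -, q5, -, -, -⟩ := hd₂'
  -- the trivial sides
  by_cases hnd₁ : j < l₁' + h₂'
  · exact lconv_atoms_decAtT_of_not_deep x T₁ T₂ M₁ M₂ j l₁ h₁ l₁' h₁' l₂ h₂ l₂' h₂' hx0 hx1 hd₁ hd₂ o4 hw₂ hnd₁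
  by_cases hnd₂ : j < l₂' + h₁'
  · exact lconv_atoms_decAtT_of_not_deep' x T₁ T₂ M₁ M₂ j l₁ h₁ l₁' h₁' l₂ h₂ l₂' h₂' hx0 hx1 hd₁ hd₂ o2 hw₁ hnd₂
  push Not at hnd₁ hnd₂
  -- doubly deep: select the side
  have hsel := not_both_headLow (l₁' := l₁') (h₁' := h₁') (l₂' := l₂') (h₂' := h₂') p5 q5
  by_cases hA1 : 2 * ((l₁' : ℝ) + h₂') < T₁ + T₂
  · -- side 1 is A2, so side 2 is not, and its light segment is the shorter one
    have hA2 : T₁ + T₂ ≤ 2 * ((l₂' : ℝ) + h₁') := by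
      by_contra h; push Not at h; exact hsel ⟨hA1, h⟩
    have hsp : h₂' + l₁' ≤ h₁' + l₂' := by
      have : (l₂' : ℝ) + h₁' > (l₁' : ℝ) + h₂' := by linarith
      have : (l₁' + h₂' : ℕ) < l₂' + h₁' := by exact_mod_cast this
      omega
    have h := side x T₂ T₁ M₂ M₁ j l₂ h₂ l₂' h₂' l₁ h₁ l₁' h₁' hx0 hx1 (by omega) hd₂ hd₁ o3 o4 o1 o2 hw₂ hw₁ hb₂ hb₁ hnd₂ hnd₁
      (by linarith) hsp
    rw [add_comm T₂ T₁, add_comm M₂ M₁, ← lconv_comm] at h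
    exact h
  · push Not at hA1
    by_cases hsp : h₁' + l₂' ≤ h₂' + l₁'
    · exact side x T₁ T₂ M₁ M₂ j l₁ h₁ l₁' h₁' l₂ h₂ l₂' h₂' hx0 hx1 hj hd₁ hd₂ o1 o2 o3 o4 hw₁ hw₂ hb₁ hb₂ hnd₁ hnd₂ hA1 hsp
    · -- side 1 qualifies but its segment is longer: then side 2 qualifies too (else side 1's segment would be shorter) — use side 2
      push Not at hsp
      have hA2 : T₁ + T₂ ≤ 2 * ((l₂' : ℝ) + h₁') := by
        have : (h₂' + l₁' : ℕ) < h₁' + l₂' := hsp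
        have : ((h₂' : ℝ) + l₁') < (h₁' : ℝ) + l₂' := by exact_mod_cast this
        linarith
      have h := side x T₂ T₁ M₂ M₁ j l₂ h₂ l₂' h₂' l₁ h₁ l₁' h₁' hx0 hx1 (by omega) hd₂ hd₁ o3 o4 o1 o2 hw₂ hw₁ hb₂ hb₁ hnd₂ hnd₁
        (by linarith) (by omega)
      rw [add_comm T₂ T₁, add_comm M₂ M₁, ← lconv_comm] at h
      exact h

/-- **`ConvClosedT` ⟸ `LightSliceCore`.** [this work] -/
theorem convClosedT_of_lightSliceCore (hL : LightSliceCore) : ConvClosedT :=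
  convClosedT_of_atomPairsOrd (convClosedTAtomsOrd_of_lightSliceCore hL)

/-- **`LightSliceCore` ∧ (III) ⟹ `SDECConvClosed`**. [this work] -/
theorem sdecConvClosed_of_lightSliceCore (hL : LightSliceCore) (hIII : GatedConvEmptyFree) : SDECConvClosed :=
  sdecConvClosed_of_atomPairsOrd (convClosedTAtomsOrd_of_lightSliceCore hL) hIII

/-- **`LightSliceCore` ∧ (III) ⟹ `TreeBuiltDEC`**. [this work] -/
theorem treeBuiltDEC_of_lightSliceCore (hL : LightSliceCore) (hIII : GatedConvEmptyFree) : TreeBuiltDEC :=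
  treeBuiltDEC_of_sdecConvClosed (sdecConvClosed_of_lightSliceCore hL hIII)

/-! ### The piece-wise route into the light-slice core -/

/-- **THE LIGHT SLICE FROM ITS TWO PIECES**: the second atom is the mixture of its two segments (`atomLaw_eq_mixture`), so the light slice of side 1
`lconv (TP[l₁′,h₁′;γ]) (atomLaw₂)` is the mixture of the two ≤ 4-cell PIECES `lconv (TP[l₁′,h₁′;γ]) (TP[l₂,h₂;γ₂])` (light ⊗ heavy) and
`lconv (TP[l₁′,h₁′;γ]) (TP[l₂′,h₂′;γ₂′])` (light ⊗ light); if both pieces are DEC at `(T₁ + T₂, j)` (the lead's / arm-2's standalone piece lemmas: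
`tfp_core`, `twoBlob_topFlipped_…`, `lightTwoBlobDEC_holds`, …), so is the light slice (`lconv_decAtT_of_mixtures`) — lead g26's class P2 in the
explicit vocabulary. [this work] -/
theorem lightSlice_decAtT_of_pieces (x T₁ T₂ : ℝ) (M₁ M₂ j : ℕ) (l₁' h₁' l₂ h₂ l₂' h₂' : ℕ) (γ : ℝ) (hx0 : 0 < x) (hx1 : x < 1)
    (hd₂ : AtomData x T₂ j M₂ l₂ h₂ l₂' h₂')
    (hE : DECAtT x (T₁ + T₂) j (M₁ + M₂)
      (lconv M₁ M₂ (fun b => TP[l₁', h₁', γ, b]) (fun b => TP[l₂, h₂, gateOf x T₂ j l₂ h₂, b])))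
    (hC : DECAtT x (T₁ + T₂) j (M₁ + M₂)
      (lconv M₁ M₂ (fun b => TP[l₁', h₁', γ, b]) (fun b => TP[l₂', h₂', gateOf x T₂ j l₂' h₂', b]))) :
    DECAtT x (T₁ + T₂) j (M₁ + M₂) (lconv M₁ M₂ (fun b => TP[l₁', h₁', γ, b]) (atomLaw x T₂ j l₂ h₂ l₂' h₂')) := by
  classical
  obtain ⟨hl2, hl2'⟩ := hd₂.lt_of
  have hd₂' := hd₂
  obtain ⟨a1, a2, a3, a4, a5, b1, b2, b3, b4, b5, hne, c2, c1⟩ := hd₂'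
  obtain ⟨-, hg1⟩ := gateOf_bounds x T₂ j l₂ h₂ hx0 hx1 a2 a3 a5
  obtain ⟨-, hf1⟩ := gateOf_bounds x T₂ j l₂' h₂' hx0 hx1 b2 b3 b5
  have hcc : usage x T₂ j l₂ h₂ ≠ usage x T₂ j l₂' h₂' := ne_of_gt (c2.trans c1)
  have hu₂ : 0 ≤ usage x T₂ j l₂' h₂' := (usage_pos_of_compat x T₂ j l₂' h₂' hx0 hx1 b2 hl2' (Or.inr b5)).le
  have h1x : 0 < 1 - x := by linarith
  set wE := (1 - x) * (x / (1 - x) - usage x T₂ j l₂' h₂') * (1 + usage x T₂ j l₂ h₂) / (usage x T₂ j l₂ h₂ - usage x T₂ j l₂' h₂') with hwE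
  set wC := (1 - x) * (usage x T₂ j l₂ h₂ - x / (1 - x)) * (1 + usage x T₂ j l₂' h₂') / (usage x T₂ j l₂ h₂ - usage x T₂ j l₂' h₂') with hwC
  have hwE0 : 0 ≤ wE := div_nonneg (mul_nonneg (mul_nonneg h1x.le (by linarith)) (by linarith [hu₂.trans_lt c2])) (by linarith)
  have hwC0 : 0 ≤ wC := div_nonneg (mul_nonneg (mul_nonneg h1x.le (by linarith)) (by linarith)) (by linarith)
  have hws : wE + wC = 1 := atomWeights_sum x T₂ j l₂ h₂ l₂' h₂' hx1 hcc
  refine lconv_decAtT_of_mixtures x (T₁ + T₂) j (M₁ + M₂) M₁ M₂ (fun b => TP[l₁', h₁', γ, b]) (atomLaw x T₂ j l₂ h₂ l₂' h₂')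
    (fun _ : Unit => 1) (fun _ b => TP[l₁', h₁', γ, b]) (fun r : Bool => if r then wE else wC)
    (fun r b => if r then TP[l₂, h₂, gateOf x T₂ j l₂ h₂, b] else TP[l₂', h₂', gateOf x T₂ j l₂' h₂', b])
    (fun _ => zero_le_one) (by simp) (fun b => by simp) (fun r => ?_) ?_ (fun b => ?_) (fun _ r _ _ => ?_)
  · cases r
    · simp only [Bool.false_eq_true, if_false]; exact hwC0
    · simp only [if_true]; exact hwE0
  · rw [Fintype.sum_bool]; simp only [if_true, Bool.false_eq_true, if_false]; exact hws
  · rw [Fintype.sum_bool]; simp only [if_true, Bool.false_eq_true, if_false]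
    rw [hwE, hwC]; exact atomLaw_eq_mixture x T₂ j l₂ h₂ l₂' h₂' hx1 hcc hg1 hf1 b
  · cases r
    · simp only [Bool.false_eq_true, if_false]; exact hC
    · simp only [if_true]; exact hE

end LawDec

/-- **`LightSliceCore` ∧ (III) ⟹ `Quant.TreeDEC`**. [this work] -/
theorem treeDEC_of_lightSliceCore (hL : LawDec.LightSliceCore) (hIII : LawDec.GatedConvEmptyFree) : TreeDEC :=
  treeDEC_of_sdecConvClosed (LawDec.sdecConvClosed_of_lightSliceCore hL hIII)

/-- **`LightSliceCore` ∧ (III) ⟹ `Quant.FarTreeRow`** — FAR on trees from ONE light-slice inequality family and Conjecture E.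
CONDITIONAL: both hypotheses are `@[conjecture]`. [this work] -/
theorem farTreeRow_of_lightSliceCore (hL : LawDec.LightSliceCore) (hIII : LawDec.GatedConvEmptyFree) : FarTreeRow :=
  farTreeRow_of_sdecConvClosed (LawDec.sdecConvClosed_of_lightSliceCore hL hIII)

end Quant

end Summit.CriticalPhenomena.PercolationContinuityZ3.Theorems
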